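import Mathlib
import Summits.ResolutionOfSingularities.ResolutionOfSingularities.Theorems.HomologicalConductorPersistenceCyclicQuotientNumerationMinima
import HarnessLib

/-!
# Rung S-2 `PersistenceSurface` (stmt-ResolutionOfSingularities-19970), stub C1 (`Sat₄`) on the toric class —
# S4: the GREEDY STAIRCASE of a weight class (drops = greedy digits along the `i`-series) and its COVER property

Route `ResolutionOfSingularities/HomologicalConductor`, rung S-2 `PersistenceSurface` (stmt-19970), registered stub
`stub_saturationFourSurfaceResidualFour`, class (iii) «`Sat₄` at non-Gorenstein rational (toric) stages».
[OURS · cell decomp-res · seat leafhand-res-homologicalconduct-13 gen 1; AI-written, weaker than expert review; NOT a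
statement of the manuscript under review (Hironaka 2017), and no statement of that manuscript is used.]

Pure `ℕ`-combinatorics of a Hirzebruch–Jung chain `(e, i, b)` (`n = i 0`, `q = i 1`) with its `j`-series.  For a
weight `α < n` the GREEDY STAIRCASE is `c 0 = α`, `pos 0 = 0`, and while `c t ≠ 0`: `σ t =` the place with
`i (σ t) ≤ c t < i (σ t - 1)`, `c (t+1) = c t − i (σ t)`, `pos (t+1) = pos t + j (σ t)`; it stops at `c μ = 0`.

* **`exists_greedyStaircase`** — existence (def-free) with: `c` non-increasing, `pos` non-decreasing, the DROP RULE
  on `[0, μ)`, `c = 0` and `pos` constant from `μ` on, the CLASS CERTIFICATES `c t + q pos t = α + n K` and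
  `c t + q pos (t+1) = α + i (σ t) + n K'` (F1), and the **COVER PROPERTY**: every column `x ≤ pos μ` is dominated by
  the last generator `pos t ≤ x` — any `v < n` with `v + q (x − pos t) ≡ c t (mod n)` has `c t ≤ v` (LEMMA F2 of part
  `…NumerationMinima`: between two generators the residues `(c t − q d) mod n`, `1 ≤ d < j (σ t)`, exceed `c t`).
  In the language of parts 21–22 (`isotypic_le_span_of_cover`, `isSyzygy_one_staircase_of_lt`): the monomials
  `u^{c t} v^{pos t}` generate the piece `M_a` (`a.val = α`) and `Ω M_a ≅ Π_{t < μ} M_{−i (σ t)}` — the drops of the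
  staircase ARE `i`-series elements (S4, first half).
* **`greedy_run`**, **`exists_greedy_visit`**, **`exists_greedy_hit`** — S4, second half: the staircase visits the
  greedy remainders `τ s` (`τ 0 = α`, `τ s = τ (s-1) % i s`) in order, dropping `i (s+1)` exactly
  `τ s / i (s+1)` times; hence a positive greedy digit at place `s + 1` (`i (s+1) ≤ τ s`) yields a drop
  `σ p = s + 1`, `p < μ`.  With part 3's NUMERATION LEMMA `exists_source_of_target` this is the retract input `hD`
  of `…CyclicQuotientIsotypic.cohomologyAnnihilator_eq_four_of_isotypicData` on the whole cyclic class.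

No crux, kill test or summit statement is proved here; the assembly is the next part.

References: J. Wunram, Math. Ann. 279 (1988) and O. Riemenschneider, Math. Ann. 209 (1974) (classical language, not
premises); HAND10G2-TORIC-FAMILIES §1/§6, HAND13-NUMERATION §2 (OURS, cell memos) for the statements being typed.
-/

-- single-problem summit: the doubled namespace component `ResolutionOfSingularities` is forced
set_option linter.dupNamespace false

namespace Summit.ResolutionOfSingularities.ResolutionOfSingularities.Theorems.HomologicalConductor.PersistenceCyclicQuotientNumeration

/-! ## The greedy staircase of a weight -/

set_option maxHeartbeats 400000 in
/-- **THE GREEDY STAIRCASE EXISTS, DROPS `i`-SERIES ELEMENTS, AND COVERS.**  For a Hirzebruch–Jung chain `(e, i, b)`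
with `j`-series `j` and a weight `α < i 0`: there are `μ` and `c pos σ : ℕ → ℕ` with `c 0 = α`, `pos 0 = 0`, `c`
antitone, `pos` monotone, `c μ = 0`, `c t = 0 ∧ pos t = pos μ` for `t ≥ μ`; the drop rule on `t < μ`
(`1 ≤ σ t ≤ e`, `i (σ t) ≤ c t < i (σ t - 1)`, `c t = c (t+1) + i (σ t)`, `pos (t+1) = pos t + j (σ t)`, and the
syzygy-class certificate `c t + i 1 · pos (t+1) = α + i (σ t) + i 0 · K`); the class certificate
`c t + i 1 · pos t = α + i 0 · K`; and the cover property: for `x ≤ pos μ` some `t ≤ μ` has `pos t ≤ x` and every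
`v < i 0` with `(v + i 1 (x − pos t)) % i 0 = c t % i 0` satisfies `c t ≤ v`. [folklore; OURS · cell decomp-res] -/
theorem exists_greedyStaircase {e : ℕ} {i b j : ℕ → ℕ} (hie : i e = 1) (hie1 : i (e + 1) = 0)
    (hrec : ∀ s, 1 ≤ s → s ≤ e → i (s - 1) + i (s + 1) = b s * i s) (hb : ∀ s, 1 ≤ s → s ≤ e → 2 ≤ b s)
    (hj0 : j 0 = 0) (hj1 : j 1 = 1) (hjrec : ∀ s, 1 ≤ s → s ≤ e → j (s - 1) + j (s + 1) = b s * j s)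
    (hjmono : ∀ s, s ≤ e → j s ≤ j (s + 1)) (α : ℕ) (hα : α < i 0) :
    ∃ (μ : ℕ) (c pos σ : ℕ → ℕ), c 0 = α ∧ pos 0 = 0 ∧ Antitone c ∧ Monotone pos ∧ c μ = 0 ∧
      (∀ t, μ ≤ t → c t = 0 ∧ pos t = pos μ) ∧
      (∀ t, t < μ → 1 ≤ σ t ∧ σ t ≤ e ∧ i (σ t) ≤ c t ∧ c t < i (σ t - 1) ∧ c t = c (t + 1) + i (σ t) ∧
        pos (t + 1) = pos t + j (σ t) ∧ ∃ K, c t + i 1 * pos (t + 1) = α + i (σ t) + i 0 * K) ∧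
      (∀ t, ∃ K, c t + i 1 * pos t = α + i 0 * K) ∧
      (∀ x, x ≤ pos μ → ∃ t, t ≤ μ ∧ pos t ≤ x ∧
        ∀ v, v < i 0 → (v + i 1 * (x - pos t)) % i 0 = c t % i 0 → c t ≤ v) := by
  classical
  have h2 := two_mul_le_of_chain hrec hb
  have hlt := lt_of_chain hie hie1 h2
  have hle := le_of_chain hie hie1 h2
  -- the selector: least place `s` with `i s ≤ v`
  have hex : ∀ v : ℕ, ∃ s, i s ≤ v := fun v => ⟨e + 1, by rw [hie1]; exact Nat.zero_le v⟩
  let sel : ℕ → ℕ := fun v => Nat.find (hex v)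
  have hsel_le : ∀ v, i (sel v) ≤ v := fun v => Nat.find_spec (hex v)
  have hsel_min : ∀ v s, s < sel v → v < i s := fun v s hs => by
    have := Nat.find_min (hex v) hs; omega
  have hsel : ∀ v, 1 ≤ v → v < i 0 → 1 ≤ sel v ∧ sel v ≤ e ∧ i (sel v) ≤ v ∧ v < i (sel v - 1) := by
    intro v hv1 hvn
    have h1 : 1 ≤ sel v := by
      by_contra h0
      have : sel v = 0 := by omega
      have := hsel_le v; rw [‹sel v = 0›] at this; omega
    have h3 : sel v ≤ e := by
      by_contra h4
      have := hsel_min v e (by omega); rw [hie] at this; omega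
    exact ⟨h1, h3, hsel_le v, hsel_min v (sel v - 1) (by omega)⟩
  -- the state sequence `(c t, pos t)`
  let St : ℕ → ℕ × ℕ := fun t =>
    Nat.rec ((α, 0) : ℕ × ℕ) (fun _ p => if p.1 = 0 then p else (p.1 - i (sel p.1), p.2 + j (sel p.1))) t
  have hSt0 : St 0 = (α, 0) := rfl
  have hSts : ∀ t, St (t + 1) = (if (St t).1 = 0 then St t else ((St t).1 - i (sel (St t).1), (St t).2 + j (sel (St t).1))) :=
    fun _ => rfl
  let c : ℕ → ℕ := fun t => (St t).1
  let pos : ℕ → ℕ := fun t => (St t).2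
  let σ : ℕ → ℕ := fun t => sel (c t)
  have hc0 : c 0 = α := by simp only [c, hSt0]
  have hpos0 : pos 0 = 0 := by simp only [pos, hSt0]
  have hstep0 : ∀ t, c t = 0 → c (t + 1) = 0 ∧ pos (t + 1) = pos t := fun t ht => by
    have h : St (t + 1) = St t := by rw [hSts, if_pos (show (St t).1 = 0 from ht)]
    exact ⟨(congrArg Prod.fst h).trans ht, congrArg Prod.snd h⟩
  have hstep1 : ∀ t, c t ≠ 0 → c (t + 1) = c t - i (σ t) ∧ pos (t + 1) = pos t + j (σ t) := fun t ht => by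
    have h : St (t + 1) = ((St t).1 - i (sel (St t).1), (St t).2 + j (sel (St t).1)) := by
      rw [hSts, if_neg (show (St t).1 ≠ 0 from ht)]
    exact ⟨congrArg Prod.fst h, congrArg Prod.snd h⟩
  -- `c` is bounded by `α` and decreases while positive
  have hcα : ∀ t, c t ≤ α := by
    intro t
    induction t with
    | zero => rw [hc0]
    | succ t ih =>
      by_cases ht : c t = 0
      · rw [(hstep0 t ht).1]; exact Nat.zero_le _
      · rw [(hstep1 t ht).1]; omega
  have hσ : ∀ t, c t ≠ 0 → 1 ≤ σ t ∧ σ t ≤ e ∧ i (σ t) ≤ c t ∧ c t < i (σ t - 1) := fun t ht =>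
    hsel (c t) (Nat.pos_of_ne_zero ht) (lt_of_le_of_lt (hcα t) hα)
  have hdec : ∀ t, c t = 0 ∨ c t + t ≤ α := by
    intro t
    induction t with
    | zero => right; rw [hc0, Nat.add_zero]
    | succ t ih =>
      by_cases ht : c t = 0
      · left; exact (hstep0 t ht).1
      · right
        have h1 := (hstep1 t ht).1
        have h3 := (hσ t ht).2.2.1
        have h4 : 1 ≤ i (σ t) := one_le_of_chain hie hie1 h2 _ (hσ t ht).2.1
        rcases ih with h | h
        · exact absurd h ht
        · omega
  have hexμ : ∃ t, c t = 0 := ⟨α + 1, by rcases hdec (α + 1) with h | h; exact h; omega⟩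
  let μ := Nat.find hexμ
  have hcμ : c μ = 0 := Nat.find_spec hexμ
  have hcpos : ∀ t, t < μ → c t ≠ 0 := fun t ht => Nat.find_min hexμ ht
  have hafter : ∀ t, μ ≤ t → c t = 0 ∧ pos t = pos μ := by
    intro t ht
    induction t, ht using Nat.le_induction with
    | base => exact ⟨hcμ, rfl⟩
    | succ t _ ih => have h := hstep0 t ih.1; exact ⟨h.1, h.2.trans ih.2⟩
  have hanti : Antitone c := by
    refine antitone_nat_of_succ_le fun t => ?_
    by_cases ht : c t = 0
    · rw [(hstep0 t ht).1, ht]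
    · rw [(hstep1 t ht).1]; exact Nat.sub_le _ _
  have hmono : Monotone pos := by
    refine monotone_nat_of_le_succ fun t => ?_
    by_cases ht : c t = 0
    · rw [(hstep0 t ht).2]
    · rw [(hstep1 t ht).2]; exact Nat.le_add_right _ _
  -- the class certificates
  have hclass : ∀ t, ∃ K, c t + i 1 * pos t = α + i 0 * K := by
    intro t
    induction t with
    | zero => exact ⟨0, by rw [hc0, hpos0]; ring⟩
    | succ t ih =>
      obtain ⟨K, hK⟩ := ih
      by_cases ht : c t = 0
      · obtain ⟨h1, h3⟩ := hstep0 t ht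
        exact ⟨K, by rw [h1, h3, ← hK, ht]⟩
      · obtain ⟨h1, h3⟩ := hstep1 t ht
        obtain ⟨hs1, hse, hic, -⟩ := hσ t ht
        obtain ⟨kσ, hkσ⟩ := exists_kSeries hrec hb hj0 hj1 hjrec (σ t) hs1 (by omega)
        refine ⟨K + kσ, ?_⟩
        rw [h1, h3, Nat.mul_add, ← hkσ]
        have : c t - i (σ t) + i (σ t) = c t := Nat.sub_add_cancel hic
        nlinarith [this, hK]
  have hclass' : ∀ t, t < μ → ∃ K, c t + i 1 * pos (t + 1) = α + i (σ t) + i 0 * K := by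
    intro t ht
    obtain ⟨K, hK⟩ := hclass t
    obtain ⟨-, h3⟩ := hstep1 t (hcpos t ht)
    obtain ⟨hs1, hse, -, -⟩ := hσ t (hcpos t ht)
    obtain ⟨kσ, hkσ⟩ := exists_kSeries hrec hb hj0 hj1 hjrec (σ t) hs1 (by omega)
    refine ⟨K + kσ, ?_⟩
    rw [h3, Nat.mul_add, ← hkσ]
    nlinarith [hK]
  refine ⟨μ, c, pos, σ, hc0, hpos0, hanti, hmono, hcμ, hafter, fun t ht => ?_, hclass, ?_⟩
  · obtain ⟨h1, h3⟩ := hstep1 t (hcpos t ht)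
    obtain ⟨hs1, hse, hic, hci⟩ := hσ t (hcpos t ht)
    exact ⟨hs1, hse, hic, hci, by rw [h1]; omega, h3, hclass' t ht⟩
  · -- the cover property
    intro x hx
    have hP0 : pos 0 ≤ x := by rw [hpos0]; exact Nat.zero_le _
    let t := Nat.findGreatest (fun t => pos t ≤ x) μ
    have ht_spec : pos t ≤ x := Nat.findGreatest_spec (P := fun t => pos t ≤ x) (Nat.zero_le μ) hP0
    have htμ : t ≤ μ := Nat.findGreatest_le μ
    have ht_max : ∀ t', t < t' → t' ≤ μ → ¬ pos t' ≤ x := fun t' h1 h3 =>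
      Nat.findGreatest_is_greatest (P := fun t => pos t ≤ x) (n := μ) h1 h3
    refine ⟨t, htμ, ht_spec, fun v hv hmod => ?_⟩
    have hn : 1 ≤ i 0 := by omega
    have hct : c t < i 0 := lt_of_le_of_lt (hcα t) hα
    rw [Nat.mod_eq_of_lt hct] at hmod
    rcases Nat.eq_or_lt_of_le htμ with hteq | htlt
    · -- `t = μ`: `c μ = 0`
      rw [show c t = 0 by rw [hteq]; exact hcμ]; exact Nat.zero_le _
    · -- `t < μ`: `x < pos (t+1) = pos t + j (σ t)`
      obtain ⟨-, h3⟩ := hstep1 t (hcpos t htlt)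
      obtain ⟨hs1, hse, -, hci⟩ := hσ t (hcpos t htlt)
      have hxlt : x < pos t + j (σ t) := by
        have := ht_max (t + 1) (Nat.lt_succ_self t) htlt; rw [h3] at this; omega
      rcases Nat.eq_zero_or_pos (x - pos t) with hd0 | hd0
      · -- on the generator
        rw [hd0, Nat.mul_zero, Nat.add_zero, Nat.mod_eq_of_lt hv] at hmod
        rw [hmod]
      · -- strictly between two generators: LEMMA F2
        have hF2 := le_mod_of_lt_jSeries hie hie1 hrec hb hj0 hj1 hjrec hjmono (σ t) hs1 (by omega) (x - pos t)
          hd0 (by omega)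
        have hg : c t < i 1 * (x - pos t) % i 0 := lt_of_lt_of_le hci hF2
        have hglt : i 1 * (x - pos t) % i 0 < i 0 := Nat.mod_lt _ (by omega)
        rw [Nat.add_mod, Nat.mod_eq_of_lt hv] at hmod
        -- `v + g ≡ c t`, `c t < g < n`, `v < n` ⇒ `v = c t + n - g > c t`
        have hsum : (v + i 1 * (x - pos t) % i 0) % i 0 = c t := hmod
        rcases Nat.lt_or_ge (v + i 1 * (x - pos t) % i 0) (i 0) with hcase | hcase
        · rw [Nat.mod_eq_of_lt hcase] at hsum; omega
        · have h5 : (v + i 1 * (x - pos t) % i 0) % i 0 = v + i 1 * (x - pos t) % i 0 - i 0 := by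
            rw [Nat.mod_eq_sub_mod hcase, Nat.mod_eq_of_lt (by omega)]
          rw [h5] at hsum; omega

/-! ## The staircase visits the greedy remainders (drops = greedy digits, second half) -/

/-- **One run of the greedy staircase.**  If the staircase (drop rule on `[0, μ)`, `c μ = 0`) is at
`c p = v` with `v < i s`, `s + 1 ≤ e`, then for `m ≤ v / i (s+1)`: `p + m ≤ μ`, `c (p + m) = v − m · i (s+1)`, and
while `m < v / i (s+1)` the drop is `σ (p + m) = s + 1` (with `p + m < μ`). [folklore; OURS · cell decomp-res] -/
theorem greedy_run {e : ℕ} {i : ℕ → ℕ} (hie : i e = 1) (hie1 : i (e + 1) = 0)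
    (h2 : ∀ s, 1 ≤ s → s ≤ e → 2 * i s ≤ i (s - 1) + i (s + 1))
    {μ : ℕ} {c σ : ℕ → ℕ} (hcμ : c μ = 0)
    (hdrop : ∀ t, t < μ → 1 ≤ σ t ∧ σ t ≤ e ∧ i (σ t) ≤ c t ∧ c t < i (σ t - 1) ∧ c t = c (t + 1) + i (σ t))
    (s p v : ℕ) (hse : s + 1 ≤ e) (hpμ : p ≤ μ) (hcp : c p = v) (hvs : v < i s) :
    ∀ m, m ≤ v / i (s + 1) → (p + m ≤ μ ∧ c (p + m) = v - m * i (s + 1)) ∧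
      (m < v / i (s + 1) → p + m < μ ∧ σ (p + m) = s + 1) := by
  have hle := le_of_chain hie hie1 h2
  have hi1 : 1 ≤ i (s + 1) := one_le_of_chain hie hie1 h2 (s + 1) hse
  set D := v / i (s + 1) with hD
  have hDv : D * i (s + 1) ≤ v := Nat.div_mul_le_self _ _
  -- the inductive step, used twice
  have aux : ∀ m, m < D → p + m ≤ μ → c (p + m) = v - m * i (s + 1) →
      p + m < μ ∧ σ (p + m) = s + 1 ∧ c (p + m + 1) = v - (m + 1) * i (s + 1) := by
    intro m hm hpm hc
    have hge : i (s + 1) ≤ c (p + m) := by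
      rw [hc]
      have : (m + 1) * i (s + 1) ≤ D * i (s + 1) := Nat.mul_le_mul_right _ hm
      rw [Nat.add_mul, Nat.one_mul] at this
      omega
    have hlt : p + m < μ := by
      rcases Nat.eq_or_lt_of_le hpm with h | h
      · rw [h, hcμ] at hge; omega
      · exact h
    obtain ⟨hs1, hsE, hic, hci, hnext⟩ := hdrop (p + m) hlt
    have hσ1 : s + 1 ≤ σ (p + m) := by
      by_contra hcon
      have : i s ≤ i (σ (p + m)) := hle _ _ (by omega) (by omega)
      have : c (p + m) ≤ v := by rw [hc]; exact Nat.sub_le _ _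
      omega
    have hσ2 : σ (p + m) ≤ s + 1 := by
      by_contra hcon
      have : i (σ (p + m) - 1) ≤ i (s + 1) := hle _ _ (by omega) (by omega)
      omega
    have hσeq : σ (p + m) = s + 1 := le_antisymm hσ2 hσ1
    refine ⟨hlt, hσeq, ?_⟩
    rw [hσeq] at hnext
    rw [show p + m + 1 = p + m + 1 from rfl, Nat.add_mul, Nat.one_mul]
    omega
  intro m hm
  have main : p + m ≤ μ ∧ c (p + m) = v - m * i (s + 1) := by
    induction m with
    | zero => exact ⟨by simpa using hpμ, by rw [Nat.zero_mul, Nat.sub_zero, Nat.add_zero]; exact hcp⟩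
    | succ m ih =>
      obtain ⟨h1, h3⟩ := ih (by omega)
      obtain ⟨h4, -, h6⟩ := aux m (by omega) h1 h3
      exact ⟨by omega, by rw [← Nat.add_assoc]; exact h6⟩
  refine ⟨main, fun hmD => ?_⟩
  obtain ⟨h4, h5, -⟩ := aux m hmD main.1 main.2
  exact ⟨h4, h5⟩

/-- **The greedy staircase VISITS the greedy remainders**: with `τ 0 = c 0 < i 0` and `τ s = τ (s-1) % i s`, for every
`s ≤ e` some `p ≤ μ` has `c p = τ s` (and `τ s < i s`). [folklore; OURS · cell decomp-res] -/
theorem exists_greedy_visit {e : ℕ} {i : ℕ → ℕ} (hie : i e = 1) (hie1 : i (e + 1) = 0)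
    (h2 : ∀ s, 1 ≤ s → s ≤ e → 2 * i s ≤ i (s - 1) + i (s + 1))
    {μ : ℕ} {c σ : ℕ → ℕ} (hcμ : c μ = 0)
    (hdrop : ∀ t, t < μ → 1 ≤ σ t ∧ σ t ≤ e ∧ i (σ t) ≤ c t ∧ c t < i (σ t - 1) ∧ c t = c (t + 1) + i (σ t))
    (hc0 : c 0 < i 0) (τ : ℕ → ℕ) (hτ0 : τ 0 = c 0) (hτ : ∀ s, 1 ≤ s → s ≤ e → τ s = τ (s - 1) % i s) :
    ∀ s, s ≤ e → ∃ p, p ≤ μ ∧ c p = τ s ∧ τ s < i s := by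
  intro s hs
  induction s with
  | zero => exact ⟨0, Nat.zero_le _, hτ0.symm, by rw [hτ0]; exact hc0⟩
  | succ s ih =>
    obtain ⟨p, hpμ, hcp, hτs⟩ := ih (by omega)
    have hi1 : 1 ≤ i (s + 1) := one_le_of_chain hie hie1 h2 (s + 1) hs
    obtain ⟨⟨h1, h3⟩, -⟩ := greedy_run hie hie1 h2 hcμ hdrop s p (τ s) hs hpμ hcp hτs (τ s / i (s + 1)) le_rfl
    refine ⟨p + τ s / i (s + 1), h1, ?_, ?_⟩
    · rw [h3, hτ (s + 1) (by omega) hs, Nat.add_sub_cancel, Nat.mod_eq_sub_mul_div, Nat.mul_comm]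
    · rw [hτ (s + 1) (by omega) hs, Nat.add_sub_cancel]; exact Nat.mod_lt _ (by omega)

/-- **A positive greedy digit is a drop of the staircase**: if `i (s+1) ≤ τ s` (`s + 1 ≤ e`), then `σ p = s + 1`
for some `p < μ` — the piece `M_{−i (s+1)}` is a factor of the staircase syzygy `Π_{t < μ} M_{−i (σ t)}`.
[folklore; OURS · cell decomp-res] -/
theorem exists_greedy_hit {e : ℕ} {i : ℕ → ℕ} (hie : i e = 1) (hie1 : i (e + 1) = 0)
    (h2 : ∀ s, 1 ≤ s → s ≤ e → 2 * i s ≤ i (s - 1) + i (s + 1))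
    {μ : ℕ} {c σ : ℕ → ℕ} (hcμ : c μ = 0)
    (hdrop : ∀ t, t < μ → 1 ≤ σ t ∧ σ t ≤ e ∧ i (σ t) ≤ c t ∧ c t < i (σ t - 1) ∧ c t = c (t + 1) + i (σ t))
    (hc0 : c 0 < i 0) (τ : ℕ → ℕ) (hτ0 : τ 0 = c 0) (hτ : ∀ s, 1 ≤ s → s ≤ e → τ s = τ (s - 1) % i s)
    (s : ℕ) (hse : s + 1 ≤ e) (hdigit : i (s + 1) ≤ τ s) : ∃ p, p < μ ∧ σ p = s + 1 := by
  obtain ⟨p, hpμ, hcp, hτs⟩ := exists_greedy_visit hie hie1 h2 hcμ hdrop hc0 τ hτ0 hτ s (by omega)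
  have hi1 : 1 ≤ i (s + 1) := one_le_of_chain hie hie1 h2 (s + 1) hse
  have hD : 0 < τ s / i (s + 1) := Nat.div_pos hdigit (by omega)
  obtain ⟨-, h⟩ := greedy_run hie hie1 h2 hcμ hdrop s p (τ s) hse hpμ hcp hτs 0 (Nat.zero_le _)
  obtain ⟨h4, h5⟩ := h hD
  exact ⟨p + 0, h4, h5⟩

end Summit.ResolutionOfSingularities.ResolutionOfSingularities.Theorems.HomologicalConductor.PersistenceCyclicQuotientNumeration
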